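import Literature.MathematicalPhysics.QuantumFieldTheory.WilsonFinTorusMagneticFluxSectorsPopulated
import Literature.MathematicalPhysics.QuantumFieldTheory.WilsonFinTorusFluxEnergies
import HarnessLib

/-!
# 't Hooft's flux ENERGIES with magnetic flux: the zero-temperature limit of `F(e, m; a, β)` above the ground state
# of the magnetic sector exists for every populated flux, vanishes for `e = 0` and is `≥ −log tanh(3Nβ·abc) > 0` for `e ≠ 0`

Topic `Literature/MathematicalPhysics/QuantumFieldTheory`; sequel of `WilsonFinTorusMagneticFluxSectors.lean` (the electric
sectors `Z_{ψ,m} = wilsonFinTorusMagneticFluxPartition ρ β zM φ ψ` at a fixed magnetic twist tensor; 't Hooft's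
`e^{−βF(e,m;a,β)} = wilsonFinTorusFluxTransform …` is real, `≥ 0`, with Hopf decay at fixed `m`),
`WilsonFinTorusMagneticFluxSectorsPopulated.lean` (every electric flux populated in every magnetic sector) and
`WilsonFinTorusFluxEnergies.lean` (the same energies WITHOUT magnetic flux, `wilsonFinTorusFluxEnergy`); kernel level:
`Literature/Analysis/OperatorTheory/TwistedKernelFluxEnergies.lean` (sector tops `Λ_ψ`, 't Hooft's limit).

AS PRINTED.  G. 't Hooft, Nucl. Phys. B 153 (1979) 141, §5 (5.1)–(5.4) and the sentence after (5.4): «In the limit β → ∞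
(or T → 0), F becomes the energy of the lowest state with the given flux configuration» (reprint C. Rebbi (ed.) 1983,
p. 553), for a state «restricted to have a fixed magnetic flux (m₁, m₂, m₃) and a fixed electric flux (e₁, e₂, e₃)».  Here the
inverse temperature is the temporal period `M + 2` and the energies are measured from the ground state OF THE MAGNETIC SECTOR
(`e = 0` at the same `m`):

* `wilsonFinTorusMagneticFluxEnergy ρ β zM φ ψ b₁ b₂ b₃ := lim_M (1/M) · log (Re Z_{0,m}(M+2) / Re Z_{ψ,m}(M+2))` — the energy
  of the electric flux `ψ` above the ground state of the magnetic sector `zM` (`Γ`-family version; `zM = 1`: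
  `wilsonFinTorusFluxEnergy`, `…_one`);
* `wilsonFinTorusFluxTransformEnergy ρ β φ ψ₀ ψ₁ ψ₂ m₁₂ m₀₂ m₀₁ a b c := lim_M (1/M) · log (Re e^{−F}(0|m)(M+2) / Re e^{−F}(e|m)(M+2))`
  — 't Hooft's `E(e, m; a) − E(0, m; a)` for the object of `WilsonFinTorusTHooftDuality.lean` (BRIDGE
  `wilsonFinTorusFluxTransformEnergy_eq_magneticFluxEnergy`).

PROVED (`β ≥ 0`, continuous unitary `ρ` of a compact metrisable `G`, hom-like central twists; «populated» = `0 < Re Z_{ψ,m}(3)`,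
DISCHARGED for every flux seen by `ρ` by the companion file):

* ★ `tendsto_wilsonFinTorusMagneticFluxEnergy` — the limit exists (= `log λ₀(m) − log Λ_ψ(m)`); `…_zero` (`= 0` at `ψ = 0`);
  `…_nonneg`; ★ `neg_log_tanh_le_wilsonFinTorusMagneticFluxEnergy`, `…_pos` — a populated NON-ZERO electric flux costs at least
  Hopf's gap `−log tanh(3Nβ·b₁b₂b₃) > 0` above the ground state of ANY magnetic sector; `re_…_le_exp_neg_mul` (finite temperature);
  `exists_tendsto_log_wilsonFinTorusMagneticFluxPartition_div` (un-normalised: `(1/M) log Re Z_{ψ,m}(M+2) → log Λ_ψ(m)`);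
* unconditional versions `…_of_flux` for `ψ = n₀ψ₀ + n₁ψ₁ + n₂ψ₂` with room (`β > 0`, `N ≥ 1`, sides `≥ 1`);
* the same list for `wilsonFinTorusFluxTransformEnergy` (★ `tendsto_wilsonFinTorusFluxTransformEnergy_of_flux`,
  ★ `wilsonFinTorusFluxTransformEnergy_pos_of_flux`, …): **for `SU(N)`-type data every `(e, m)` with `e ≠ 0` has
  `E(e,m) − E(0,m) ≥ −log tanh(3Nβ·abc) > 0` on one box, unconditionally.**

HONEST FRAMING: ONE finite box at fixed `β`; these are finite-volume LEVELS, the lower bound tends to `0` exponentially in the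
spatial volume; nothing about `a_i → ∞` ('t Hooft §7–§8: light∕heavy fluxes, `E → ρ·a`), duality consequences, an area law or a
mass gap.  The magnetic ground-state energy `E(0, m)` itself (relative to no twist) is not treated here beyond `F(0,m) ≥ 0` of
`WilsonFinTorusTwistedPartitionDomination.lean`.  The Yang–Mills mass gap (Clay) is NOT proved by any of this; R4 closes only the
conditional finite-𝕋⁴ rung `BalabanLadder.UV`.  No `instance`, no `sorry`; standard axioms.

References: 't Hooft 1979 §5, §8; Greensite 2011 §4.4; C. Michael, *Hadronic physics from the lattice* (1997) §2; E. Hopf,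
J. Math. Mech. 12 (1963) 683, Thm 4; M. Reed, B. Simon IV (1978) Thm XIII.43–44.
-/

noncomputable section

open MeasureTheory Filter Function Finset Topology
open scoped ENNReal ComplexConjugate BigOperators
open Literature.Analysis.OperatorTheory

namespace Literature.MathematicalPhysics.QuantumFieldTheory

variable {G : Type*} [Group G] [TopologicalSpace G] [IsTopologicalGroup G] [CompactSpace G]
  [MeasurableSpace G] [BorelSpace G] {N : ℕ} (ρ : G →* Matrix (Fin N) (Fin N) ℂ)
  {Γ : Type*} [AddCommGroup Γ] [Fintype Γ]

/-! ### §1 The energy of an electric flux above the ground state of a magnetic sector -/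

/-- **'t Hooft's electric-flux energy in the magnetic sector `zM` of a finite box**, measured from the ground state of that
sector: `E_{ψ|m}(b₁,b₂,b₃; β) := lim_{M → ∞} (1/M) · log (Re Z_{0,m}(M+2) / Re Z_{ψ,m}(M+2))` («In the limit β → ∞, F becomes
the energy of the lowest state with the given flux»).  Defined through `limUnder`; the limit is proved to exist for populated
sectors. [cite: tHooft1979Flux, §5 after (5.4) and §8 after (8.7)] [cite: Greensite2011, §4.4 (4.41)–(4.44)] -/
def wilsonFinTorusMagneticFluxEnergy (β : ℝ) (zM : Fin 4 → Fin 4 → G) (φ : Γ → Fin 4 → G) (ψ : AddChar Γ ℂ)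
    (b₁ b₂ b₃ : ℕ) : ℝ :=
  limUnder atTop fun M : ℕ =>
    Real.log ((wilsonFinTorusMagneticFluxPartition ρ β zM φ 0 b₁ b₂ b₃ (M + 2)).re /
        (wilsonFinTorusMagneticFluxPartition ρ β zM φ ψ b₁ b₂ b₃ (M + 2)).re) / M

/-- Unfolding lemma. [cite: tHooft1979Flux, §5 after (5.4)] -/
theorem wilsonFinTorusMagneticFluxEnergy_def (β : ℝ) (zM : Fin 4 → Fin 4 → G) (φ : Γ → Fin 4 → G) (ψ : AddChar Γ ℂ)
    (b₁ b₂ b₃ : ℕ) :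
    wilsonFinTorusMagneticFluxEnergy ρ β zM φ ψ b₁ b₂ b₃ = limUnder atTop (fun M : ℕ =>
      Real.log ((wilsonFinTorusMagneticFluxPartition ρ β zM φ 0 b₁ b₂ b₃ (M + 2)).re /
        (wilsonFinTorusMagneticFluxPartition ρ β zM φ ψ b₁ b₂ b₃ (M + 2)).re) / M) := rfl

/-- **No magnetic flux: the companion file's energy**, `E_{ψ|m=0} = wilsonFinTorusFluxEnergy ρ β φ ψ`.
[cite: tHooft1979Flux, §5 after (5.4)] -/
theorem wilsonFinTorusMagneticFluxEnergy_one (β : ℝ) (φ : Γ → Fin 4 → G) (ψ : AddChar Γ ℂ) (b₁ b₂ b₃ : ℕ) :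
    wilsonFinTorusMagneticFluxEnergy ρ β (1 : Fin 4 → Fin 4 → G) φ ψ b₁ b₂ b₃ = wilsonFinTorusFluxEnergy ρ β φ ψ b₁ b₂ b₃ := by
  simp only [wilsonFinTorusMagneticFluxEnergy, wilsonFinTorusFluxEnergy_def, wilsonFinTorusMagneticFluxPartition_one]

/-- **The ground state of the magnetic sector has energy zero** in this normalisation: `E_{0|m} = 0` (no hypotheses).
[cite: tHooft1979Flux, §8 after (8.7)] -/
theorem wilsonFinTorusMagneticFluxEnergy_zero (β : ℝ) (zM : Fin 4 → Fin 4 → G) (φ : Γ → Fin 4 → G) (b₁ b₂ b₃ : ℕ) :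
    wilsonFinTorusMagneticFluxEnergy ρ β zM φ 0 b₁ b₂ b₃ = 0 := by
  rw [wilsonFinTorusMagneticFluxEnergy_def]
  have h : (fun M : ℕ => Real.log ((wilsonFinTorusMagneticFluxPartition ρ β zM φ 0 b₁ b₂ b₃ (M + 2)).re /
      (wilsonFinTorusMagneticFluxPartition ρ β zM φ 0 b₁ b₂ b₃ (M + 2)).re) / (M : ℝ)) = fun _ => 0 := by
    funext M
    rcases eq_or_ne ((wilsonFinTorusMagneticFluxPartition ρ β zM φ 0 b₁ b₂ b₃ (M + 2)).re) 0 with h0 | h0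
    · simp [h0]
    · simp [div_self h0]
  rw [h]
  exact tendsto_const_nhds.limUnder_eq

section Spectral

variable [SecondCountableTopology G]

/-- `0 ≤ tanh x` for `0 ≤ x` (plumbing). [folklore] -/
private theorem mge_tanh_nonneg_of_nonneg {x : ℝ} (hx : 0 ≤ x) : 0 ≤ Real.tanh x := by
  rw [Real.tanh_eq_sinh_div_cosh]
  exact div_nonneg (Real.sinh_nonneg_iff.2 hx) (Real.cosh_pos x).le

/-- `tanh x < 1` (plumbing). [folklore] -/
private theorem mge_tanh_lt_one (x : ℝ) : Real.tanh x < 1 := by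
  rw [Real.tanh_eq_sinh_div_cosh, div_lt_one (Real.cosh_pos x)]
  exact Real.sinh_lt_cosh x

/-- MASTER LEMMA (plumbing): the spectral description of a populated electric sector of a MAGNETIC sector of the box — the
ground-state level `λ₀(m) = ‖𝕋_m‖`, the sector top `Λ_ψ(m)`, Hopf's ratio bound for `ψ ≠ 0`, 't Hooft's limit, the sharp
sector decay, the ground-state lower bound, positivity, and the convergence of the effective energies. [folklore] -/
private theorem magneticFluxEnergy_spectral (hρ : Continuous ρ) (hρu : ∀ g, ρ g ∈ Matrix.unitaryGroup (Fin N) ℂ)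
    {β : ℝ} (hβ : 0 ≤ β) (zM : Fin 4 → Fin 4 → G) {φ : Γ → Fin 4 → G} (hφ0 : φ 0 = 1)
    (hφadd : ∀ k k', φ (k + k') = φ k * φ k') (hφc : ∀ k (i : Fin 3), φ k i.castSucc ∈ Subgroup.center G)
    (b₁ b₂ b₃ : ℕ) {ψ : AddChar Γ ℂ} (hψ3 : 0 < (wilsonFinTorusMagneticFluxPartition ρ β zM φ ψ b₁ b₂ b₃ 3).re) :
    ∃ lam₀ Λψ : ℝ, 0 < Λψ ∧ Λψ ≤ lam₀ ∧
      (ψ ≠ 0 → Λψ ≤ Real.tanh (3 * N * β * ((b₁ : ℝ) * b₂ * b₃)) * lam₀) ∧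
      Tendsto (fun M : ℕ => Real.log ((wilsonFinTorusMagneticFluxPartition ρ β zM φ 0 b₁ b₂ b₃ (M + 2)).re /
          (wilsonFinTorusMagneticFluxPartition ρ β zM φ ψ b₁ b₂ b₃ (M + 2)).re) / M) atTop
        (𝓝 (Real.log lam₀ - Real.log Λψ)) ∧
      (∀ M : ℕ, (wilsonFinTorusMagneticFluxPartition ρ β zM φ ψ b₁ b₂ b₃ (M + 2)).re ≤
          Λψ ^ M * (wilsonFinTorusMagneticFluxPartition ρ β zM φ ψ b₁ b₂ b₃ 2).re) ∧
      (∀ M : ℕ, lam₀ ^ M * lam₀ ^ 2 ≤ (wilsonFinTorusMagneticFluxPartition ρ β zM φ 0 b₁ b₂ b₃ (M + 2)).re) ∧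
      (∀ M : ℕ, 0 < (wilsonFinTorusMagneticFluxPartition ρ β zM φ ψ b₁ b₂ b₃ (M + 2)).re) ∧
      Tendsto (fun M : ℕ => Real.log (wilsonFinTorusMagneticFluxPartition ρ β zM φ ψ b₁ b₂ b₃ (M + 2)).re / M) atTop
        (𝓝 (Real.log Λψ)) ∧
      Tendsto (fun M : ℕ =>
          Real.log ((wilsonFinTorusMagneticFluxPartition ρ β zM φ ψ b₁ b₂ b₃ (M + 2)).re /
              (wilsonFinTorusMagneticFluxPartition ρ β zM φ ψ b₁ b₂ b₃ (M + 1 + 2)).re) -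
            Real.log ((wilsonFinTorusMagneticFluxPartition ρ β zM φ 0 b₁ b₂ b₃ (M + 2)).re /
              (wilsonFinTorusMagneticFluxPartition ρ β zM φ 0 b₁ b₂ b₃ (M + 1 + 2)).re)) atTop
        (𝓝 (Real.log lam₀ - Real.log Λψ)) := by
  haveI : IsFiniteMeasure (haarProbability G) := by
    dsimp [haarProbability]; infer_instance
  obtain ⟨C, A, s, hcnt, b, lam, i₀, hC, hA, hb, hlam, hi₀, hL0⟩ :=
    exists_eigenbasis_finTorusSliceKernelTw hρ hρu hβ (finSliceTwistTensor zM : FinSpatialSite b₁ b₂ b₃ → Fin 3 → Fin 3 → G)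
  haveI : Countable s := hcnt
  have hK := stronglyMeasurable_uncurry_finTorusSliceKernelTw (b₁ := b₁) (b₂ := b₂) (b₃ := b₃) ρ hρ β
    (finSliceTwistTensor zM)
  have hsymm : ∀ x y : FinSpatialSite b₁ b₂ b₃ × Fin 3 → G,
      finTorusSliceKernelTw ρ β (finSliceTwistTensor zM) x y = finTorusSliceKernelTw ρ β (finSliceTwistTensor zM) y x :=
    finTorusSliceKernelTw_symm ρ hρu β _
  have hKpos : ∀ x y : FinSpatialSite b₁ b₂ b₃ × Fin 3 → G, 0 < finTorusSliceKernelTw ρ β (finSliceTwistTensor zM) x y :=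
    finTorusSliceKernelTw_pos ρ hρ β _
  have hT0 : (finSliceTwist (φ 0) : (FinSpatialSite b₁ b₂ b₃ × Fin 3 → G) → _) = id := by
    rw [hφ0]; exact finSliceTwist_one
  have hTadd : ∀ (k k' : Γ) (x : FinSpatialSite b₁ b₂ b₃ × Fin 3 → G),
      finSliceTwist (φ (k + k')) x = finSliceTwist (φ k) (finSliceTwist (φ k') x) := fun k k' x => by
    rw [finSliceTwist_finSliceTwist, hφadd]
  have hT : ∀ k : Γ, MeasurePreserving (finSliceTwist (φ k) : (FinSpatialSite b₁ b₂ b₃ × Fin 3 → G) → _)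
      (Measure.pi fun _ => haarProbability G) (Measure.pi fun _ => haarProbability G) :=
    fun k => measurePreserving_finSliceTwist (φ k)
  have hKT : ∀ (k : Γ) (x y : FinSpatialSite b₁ b₂ b₃ × Fin 3 → G),
      finTorusSliceKernelTw ρ β (finSliceTwistTensor zM) (finSliceTwist (φ k) x) (finSliceTwist (φ k) y) =
        finTorusSliceKernelTw ρ β (finSliceTwistTensor zM) x y :=
    fun k x y => finTorusSliceKernelTw_finSliceTwist ρ (hφc k) β _ x y
  have hz : ∀ (k : Γ) (M : ℕ),
      (fun k n => wilsonFinTorusTensorTwistedPartition ρ β (elecMagTwistTensor (φ k) zM) b₁ b₂ b₃ n) k (M + 2) =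
      ∫ x, ((fun f : (FinSpatialSite b₁ b₂ b₃ × Fin 3 → G) → ℝ => fun u =>
            ∫ y, finTorusSliceKernelTw ρ β (finSliceTwistTensor zM) u y * f y
              ∂(Measure.pi fun _ : FinSpatialSite b₁ b₂ b₃ × Fin 3 => haarProbability G))^[M + 1]
          (fun y => finTorusSliceKernelTw ρ β (finSliceTwistTensor zM) y x)) (finSliceTwist (φ k) x)
        ∂(Measure.pi fun _ : FinSpatialSite b₁ b₂ b₃ × Fin 3 => haarProbability G) :=
    fun k M => wilsonFinTorusTensorTwistedPartition_elecMag_eq_integral_iterate ρ hρ β (hφc k) zM b₁ b₂ b₃ M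
  have hlam0 : ∀ i, 0 ≤ lam i := fun i => (hlam i).1
  -- Hopf's ratio bound in the magnetic sector: `λᵢ ≤ τ λ₀` off the top index
  have hHopf : ∀ i, i ≠ i₀ → lam i ≤ Real.tanh (3 * N * β * ((b₁ : ℝ) * b₂ * b₃)) * lam i₀ := fun i hi => by
    have h := WilsonFinTorusHopfTw.abs_eigenvalue_le_tanh_mul (b₁ := b₁) (b₂ := b₂) (b₃ := b₃) ρ hρ hρu hβ
      (finSliceTwistTensor zM) hA b hb hi₀ hi
    rw [← hi₀] at h
    exact (le_abs_self _).trans h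
  have hτ0 : 0 ≤ Real.tanh (3 * N * β * ((b₁ : ℝ) * b₂ * b₃)) * lam i₀ :=
    mul_nonneg (mge_tanh_nonneg_of_nonneg (by positivity)) (hlam0 i₀)
  -- the sector is non-degenerate
  have hne := exists_fluxCoeff_ne_zero_of_pos (T := fun k => finSliceTwist (φ k)) hK hC hsymm hA hb hlam0 hT hz
    (ψ := ψ) hψ3
  have hne0 := exists_fluxCoeff_zero_ne_zero (T := fun k => finSliceTwist (φ k)) hK hC hsymm hKpos hA hb hT hKT hi₀ hL0
  refine ⟨lam i₀, ⨆ i : {i // ((Fintype.card Γ : ℂ)⁻¹ * ∑ k, conj (ψ k) *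
      ((∫ x, (∫ z, finTorusSliceKernelTw ρ β (finSliceTwistTensor zM) (finSliceTwist (φ k) x) z * b i z
          ∂(Measure.pi fun _ : FinSpatialSite b₁ b₂ b₃ × Fin 3 => haarProbability G)) *
        (∫ z, finTorusSliceKernelTw ρ β (finSliceTwistTensor zM) x z * b i z
          ∂(Measure.pi fun _ : FinSpatialSite b₁ b₂ b₃ × Fin 3 => haarProbability G))
        ∂(Measure.pi fun _ : FinSpatialSite b₁ b₂ b₃ × Fin 3 => haarProbability G) : ℝ) : ℂ)).re ≠ 0}, lam i,
    ?_, ?_, ?_, ?_, ?_, ?_, ?_, ?_, ?_⟩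
  · exact spectralTop_pos (lam_le_norm hb) hne
  · exact fluxTop_le_top hb hi₀ ψ
  · exact fun hψ => fluxTop_le_of_ne_zero hK hC hsymm hKpos hA hb hT hKT hi₀ hL0 hτ0 hHopf hψ
  · exact tendsto_log_fluxSector_ratio_div hK hC hsymm hKpos hA hb hlam0 hi₀ hL0 hT hT0 hTadd hKT hz hne
  · exact fun M => re_fluxSector_le_fluxTop_pow_mul hK hC hsymm hA hb hlam0 hT hT0 hTadd hz ψ M
  · exact fun M => le_re_fluxSector_zero (T := fun k => finSliceTwist (φ k)) hK hC hsymm hKpos hA hb hlam0 hi₀ hL0 hT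
      hT0 hTadd hKT hz M
  · exact fun M => re_fluxSector_pos hK hC hsymm hA hb hlam0 hT hT0 hTadd hz hne M
  · exact tendsto_log_re_fluxSector_div hK hC hsymm hA hb hlam0 hT hT0 hTadd hz hne
  · have hψlim := tendsto_fluxEffectiveEnergy hK hC hsymm hA hb hlam0 hT hT0 hTadd hz hne
    have h0lim := tendsto_fluxEffectiveEnergy hK hC hsymm hA hb hlam0 hT hT0 hTadd hz hne0
    rw [fluxTop_zero_eq hK hC hsymm hKpos hA hb hT hKT hi₀ hL0] at h0lim
    have h := hψlim.sub h0lim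
    rwa [neg_sub_neg] at h

/-- ★ **The zero-temperature limit exists in every magnetic sector** — for a populated sector (`Re Z_{ψ,m}(3) > 0`),
`(1/M) · log (Re Z_{0,m}(M+2) / Re Z_{ψ,m}(M+2)) → E_{ψ|m}` as `M → ∞` (= `log λ₀(m) − log Λ_ψ(m)`).
[cite: tHooft1979Flux, §5 after (5.4)] [cite: Greensite2011, §4.4 (4.41)–(4.44)] -/
theorem tendsto_wilsonFinTorusMagneticFluxEnergy (hρ : Continuous ρ) (hρu : ∀ g, ρ g ∈ Matrix.unitaryGroup (Fin N) ℂ)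
    {β : ℝ} (hβ : 0 ≤ β) (zM : Fin 4 → Fin 4 → G) {φ : Γ → Fin 4 → G} (hφ0 : φ 0 = 1)
    (hφadd : ∀ k k', φ (k + k') = φ k * φ k') (hφc : ∀ k (i : Fin 3), φ k i.castSucc ∈ Subgroup.center G)
    (b₁ b₂ b₃ : ℕ) {ψ : AddChar Γ ℂ} (hψ3 : 0 < (wilsonFinTorusMagneticFluxPartition ρ β zM φ ψ b₁ b₂ b₃ 3).re) :
    Tendsto (fun M : ℕ => Real.log ((wilsonFinTorusMagneticFluxPartition ρ β zM φ 0 b₁ b₂ b₃ (M + 2)).re /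
        (wilsonFinTorusMagneticFluxPartition ρ β zM φ ψ b₁ b₂ b₃ (M + 2)).re) / M) atTop
      (𝓝 (wilsonFinTorusMagneticFluxEnergy ρ β zM φ ψ b₁ b₂ b₃)) := by
  obtain ⟨lam₀, Λψ, -, -, -, ht, -⟩ := magneticFluxEnergy_spectral ρ hρ hρu hβ zM hφ0 hφadd hφc b₁ b₂ b₃ hψ3
  rw [wilsonFinTorusMagneticFluxEnergy_def, ht.limUnder_eq]
  exact ht

/-- **Flux energies above the magnetic ground state are non-negative**: `0 ≤ E_{ψ|m}` for every populated sector.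
[cite: tHooft1979Flux, §5 (5.1)–(5.4)] [cite: ReedSimonIV1978, Thm XIII.43 and Thm XIII.44] -/
theorem wilsonFinTorusMagneticFluxEnergy_nonneg (hρ : Continuous ρ) (hρu : ∀ g, ρ g ∈ Matrix.unitaryGroup (Fin N) ℂ)
    {β : ℝ} (hβ : 0 ≤ β) (zM : Fin 4 → Fin 4 → G) {φ : Γ → Fin 4 → G} (hφ0 : φ 0 = 1)
    (hφadd : ∀ k k', φ (k + k') = φ k * φ k') (hφc : ∀ k (i : Fin 3), φ k i.castSucc ∈ Subgroup.center G)
    (b₁ b₂ b₃ : ℕ) {ψ : AddChar Γ ℂ} (hψ3 : 0 < (wilsonFinTorusMagneticFluxPartition ρ β zM φ ψ b₁ b₂ b₃ 3).re) :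
    0 ≤ wilsonFinTorusMagneticFluxEnergy ρ β zM φ ψ b₁ b₂ b₃ := by
  obtain ⟨lam₀, Λψ, hΛpos, hΛle, -, ht, -⟩ := magneticFluxEnergy_spectral ρ hρ hρu hβ zM hφ0 hφadd hφc b₁ b₂ b₃ hψ3
  rw [wilsonFinTorusMagneticFluxEnergy_def, ht.limUnder_eq]
  exact sub_nonneg.2 (Real.log_le_log hΛpos hΛle)

/-- ★ **A non-zero electric flux costs at least the finite-volume gap above the ground state of any magnetic sector**:
for `ψ ≠ 0` populated, `−log tanh(3Nβ·b₁b₂b₃) ≤ E_{ψ|m}` (the ground state of the magnetic sector carries no electric flux;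
Hopf's bound in the twisted sector). [cite: tHooft1979Flux, §4 (4.3)–(4.5) and §5 after (5.4)] [cite: Hopf1963, Thm 4] -/
theorem neg_log_tanh_le_wilsonFinTorusMagneticFluxEnergy (hρ : Continuous ρ)
    (hρu : ∀ g, ρ g ∈ Matrix.unitaryGroup (Fin N) ℂ) {β : ℝ} (hβ : 0 ≤ β) (zM : Fin 4 → Fin 4 → G)
    {φ : Γ → Fin 4 → G} (hφ0 : φ 0 = 1) (hφadd : ∀ k k', φ (k + k') = φ k * φ k')
    (hφc : ∀ k (i : Fin 3), φ k i.castSucc ∈ Subgroup.center G) (b₁ b₂ b₃ : ℕ) {ψ : AddChar Γ ℂ} (hψ : ψ ≠ 0)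
    (hψ3 : 0 < (wilsonFinTorusMagneticFluxPartition ρ β zM φ ψ b₁ b₂ b₃ 3).re) :
    -Real.log (Real.tanh (3 * N * β * ((b₁ : ℝ) * b₂ * b₃))) ≤ wilsonFinTorusMagneticFluxEnergy ρ β zM φ ψ b₁ b₂ b₃ := by
  obtain ⟨lam₀, Λψ, hΛpos, hΛle, hτ, ht, -⟩ := magneticFluxEnergy_spectral ρ hρ hρu hβ zM hφ0 hφadd hφc b₁ b₂ b₃ hψ3
  rw [wilsonFinTorusMagneticFluxEnergy_def, ht.limUnder_eq]
  have hτψ := hτ hψ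
  have hlam₀ : 0 < lam₀ := lt_of_lt_of_le hΛpos hΛle
  rcases (mge_tanh_nonneg_of_nonneg (x := 3 * N * β * ((b₁ : ℝ) * b₂ * b₃)) (by positivity)).eq_or_lt with h0 | hpos
  · rw [← h0, zero_mul] at hτψ
    exact absurd hτψ (not_le.2 hΛpos)
  · have h1 : Real.log Λψ ≤ Real.log (Real.tanh (3 * N * β * ((b₁ : ℝ) * b₂ * b₃))) + Real.log lam₀ := by
      rw [← Real.log_mul hpos.ne' hlam₀.ne']
      exact Real.log_le_log hΛpos hτψ
    linarith

/-- ★ **Every populated non-zero electric flux has strictly positive energy above the ground state of its magnetic sector**: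
`0 < E_{ψ|m}` (`tanh < 1`).  One box; the bound degenerates exponentially in the spatial volume.
[cite: tHooft1979Flux, §5 after (5.4)] [cite: Hopf1963, Thm 4] -/
theorem wilsonFinTorusMagneticFluxEnergy_pos (hρ : Continuous ρ) (hρu : ∀ g, ρ g ∈ Matrix.unitaryGroup (Fin N) ℂ)
    {β : ℝ} (hβ : 0 ≤ β) (zM : Fin 4 → Fin 4 → G) {φ : Γ → Fin 4 → G} (hφ0 : φ 0 = 1)
    (hφadd : ∀ k k', φ (k + k') = φ k * φ k') (hφc : ∀ k (i : Fin 3), φ k i.castSucc ∈ Subgroup.center G)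
    (b₁ b₂ b₃ : ℕ) {ψ : AddChar Γ ℂ} (hψ : ψ ≠ 0)
    (hψ3 : 0 < (wilsonFinTorusMagneticFluxPartition ρ β zM φ ψ b₁ b₂ b₃ 3).re) :
    0 < wilsonFinTorusMagneticFluxEnergy ρ β zM φ ψ b₁ b₂ b₃ := by
  obtain ⟨lam₀, Λψ, hΛpos, hΛle, hτ, ht, -⟩ := magneticFluxEnergy_spectral ρ hρ hρu hβ zM hφ0 hφadd hφc b₁ b₂ b₃ hψ3
  rw [wilsonFinTorusMagneticFluxEnergy_def, ht.limUnder_eq]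
  have hτψ := hτ hψ
  have hlam₀ : 0 < lam₀ := lt_of_lt_of_le hΛpos hΛle
  have hlt : Λψ < lam₀ := by
    refine lt_of_le_of_lt hτψ ?_
    calc Real.tanh (3 * N * β * ((b₁ : ℝ) * b₂ * b₃)) * lam₀ < 1 * lam₀ :=
        mul_lt_mul_of_pos_right (mge_tanh_lt_one _) hlam₀
      _ = lam₀ := one_mul _
  exact sub_pos.2 (Real.log_lt_log hΛpos hlt)

/-- **The finite-temperature bound in energy form**: for a populated sector there is `c > 0` with
`Re Z_{ψ,m}(M+2) ≤ c · e^{−E_{ψ|m}·M} · Re Z_{0,m}(M+2)` for every `M`. [cite: tHooft1979Flux, §5 after (5.4)]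
[cite: ReedSimonIV1978, Thm XIII.43 and Thm XIII.44] -/
theorem re_wilsonFinTorusMagneticFluxPartition_le_exp_neg_mul (hρ : Continuous ρ)
    (hρu : ∀ g, ρ g ∈ Matrix.unitaryGroup (Fin N) ℂ) {β : ℝ} (hβ : 0 ≤ β) (zM : Fin 4 → Fin 4 → G)
    {φ : Γ → Fin 4 → G} (hφ0 : φ 0 = 1) (hφadd : ∀ k k', φ (k + k') = φ k * φ k')
    (hφc : ∀ k (i : Fin 3), φ k i.castSucc ∈ Subgroup.center G) (b₁ b₂ b₃ : ℕ) {ψ : AddChar Γ ℂ}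
    (hψ3 : 0 < (wilsonFinTorusMagneticFluxPartition ρ β zM φ ψ b₁ b₂ b₃ 3).re) :
    ∃ c : ℝ, 0 < c ∧ ∀ M : ℕ,
      (wilsonFinTorusMagneticFluxPartition ρ β zM φ ψ b₁ b₂ b₃ (M + 2)).re ≤
        c * Real.exp (-(wilsonFinTorusMagneticFluxEnergy ρ β zM φ ψ b₁ b₂ b₃ * M)) *
          (wilsonFinTorusMagneticFluxPartition ρ β zM φ 0 b₁ b₂ b₃ (M + 2)).re := by
  obtain ⟨lam₀, Λψ, hΛpos, hΛle, -, ht, hdec, hvac, hpos, -⟩ :=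
    magneticFluxEnergy_spectral ρ hρ hρu hβ zM hφ0 hφadd hφc b₁ b₂ b₃ hψ3
  rw [wilsonFinTorusMagneticFluxEnergy_def, ht.limUnder_eq]
  have hlam₀ : 0 < lam₀ := lt_of_lt_of_le hΛpos hΛle
  refine ⟨(wilsonFinTorusMagneticFluxPartition ρ β zM φ ψ b₁ b₂ b₃ 2).re / lam₀ ^ 2, div_pos (hpos 0) (pow_pos hlam₀ 2),
    fun M => ?_⟩
  have hE : Real.log lam₀ - Real.log Λψ = -Real.log (Λψ / lam₀) := by
    rw [Real.log_div hΛpos.ne' hlam₀.ne']; ring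
  rw [hE]
  have hexp' : Real.exp (-(-Real.log (Λψ / lam₀) * M)) = (Λψ / lam₀) ^ M := by
    rw [show -(-Real.log (Λψ / lam₀) * (M : ℝ)) = (M : ℝ) * Real.log (Λψ / lam₀) by ring, Real.exp_nat_mul,
      Real.exp_log (div_pos hΛpos hlam₀)]
  rw [hexp']
  calc (wilsonFinTorusMagneticFluxPartition ρ β zM φ ψ b₁ b₂ b₃ (M + 2)).re
      ≤ Λψ ^ M * (wilsonFinTorusMagneticFluxPartition ρ β zM φ ψ b₁ b₂ b₃ 2).re := hdec M
    _ = (wilsonFinTorusMagneticFluxPartition ρ β zM φ ψ b₁ b₂ b₃ 2).re / lam₀ ^ 2 * (Λψ / lam₀) ^ M *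
          (lam₀ ^ M * lam₀ ^ 2) := by
        rw [div_pow]
        field_simp
    _ ≤ (wilsonFinTorusMagneticFluxPartition ρ β zM φ ψ b₁ b₂ b₃ 2).re / lam₀ ^ 2 * (Λψ / lam₀) ^ M *
          (wilsonFinTorusMagneticFluxPartition ρ β zM φ 0 b₁ b₂ b₃ (M + 2)).re :=
        mul_le_mul_of_nonneg_left (hvac M)
          (mul_nonneg (div_pos (hpos 0) (pow_pos hlam₀ 2)).le (pow_nonneg (div_pos hΛpos hlam₀).le M))

/-- **'t Hooft's sentence, un-normalised, in a magnetic sector**: for a populated sector `(1/M) log Re Z_{ψ,m}(M+2) → log Λ_ψ(m)`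
for some `Λ_ψ(m) > 0` (the top level of the sector), and `Re Z_{ψ,m}(M+2) ≤ Λ_ψ(m)^M · Re Z_{ψ,m}(2)`.
[cite: tHooft1979Flux, §5 after (5.4)] [cite: Greensite2011, §4.4 (4.41)–(4.44)] -/
theorem exists_tendsto_log_wilsonFinTorusMagneticFluxPartition_div (hρ : Continuous ρ)
    (hρu : ∀ g, ρ g ∈ Matrix.unitaryGroup (Fin N) ℂ) {β : ℝ} (hβ : 0 ≤ β) (zM : Fin 4 → Fin 4 → G)
    {φ : Γ → Fin 4 → G} (hφ0 : φ 0 = 1) (hφadd : ∀ k k', φ (k + k') = φ k * φ k')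
    (hφc : ∀ k (i : Fin 3), φ k i.castSucc ∈ Subgroup.center G) (b₁ b₂ b₃ : ℕ) {ψ : AddChar Γ ℂ}
    (hψ3 : 0 < (wilsonFinTorusMagneticFluxPartition ρ β zM φ ψ b₁ b₂ b₃ 3).re) :
    ∃ Λψ : ℝ, 0 < Λψ ∧
      Tendsto (fun M : ℕ => Real.log (wilsonFinTorusMagneticFluxPartition ρ β zM φ ψ b₁ b₂ b₃ (M + 2)).re / M) atTop
        (𝓝 (Real.log Λψ)) ∧
      ∀ M : ℕ, (wilsonFinTorusMagneticFluxPartition ρ β zM φ ψ b₁ b₂ b₃ (M + 2)).re ≤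
        Λψ ^ M * (wilsonFinTorusMagneticFluxPartition ρ β zM φ ψ b₁ b₂ b₃ 2).re := by
  obtain ⟨lam₀, Λψ, hΛpos, -, -, -, hdec, -, -, hlim, -⟩ :=
    magneticFluxEnergy_spectral ρ hρ hρu hβ zM hφ0 hφadd hφc b₁ b₂ b₃ hψ3
  exact ⟨Λψ, hΛpos, hlim, hdec⟩

/-- **Effective flux energies in a magnetic sector**: for a populated sector the effective energies relative to the ground-state
channel, `log (Re Z_{ψ,m}(M+2)/Re Z_{ψ,m}(M+3)) − log (Re Z_{0,m}(M+2)/Re Z_{0,m}(M+3))`, converge to `E_{ψ|m}`.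
[cite: Michael1997, §2 eqs. (2)–(3)] [cite: tHooft1979Flux, §5 after (5.4)] -/
theorem tendsto_wilsonFinTorusMagneticFluxEffectiveEnergy_sub (hρ : Continuous ρ)
    (hρu : ∀ g, ρ g ∈ Matrix.unitaryGroup (Fin N) ℂ) {β : ℝ} (hβ : 0 ≤ β) (zM : Fin 4 → Fin 4 → G)
    {φ : Γ → Fin 4 → G} (hφ0 : φ 0 = 1) (hφadd : ∀ k k', φ (k + k') = φ k * φ k')
    (hφc : ∀ k (i : Fin 3), φ k i.castSucc ∈ Subgroup.center G) (b₁ b₂ b₃ : ℕ) {ψ : AddChar Γ ℂ}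
    (hψ3 : 0 < (wilsonFinTorusMagneticFluxPartition ρ β zM φ ψ b₁ b₂ b₃ 3).re) :
    Tendsto (fun M : ℕ =>
        Real.log ((wilsonFinTorusMagneticFluxPartition ρ β zM φ ψ b₁ b₂ b₃ (M + 2)).re /
            (wilsonFinTorusMagneticFluxPartition ρ β zM φ ψ b₁ b₂ b₃ (M + 1 + 2)).re) -
          Real.log ((wilsonFinTorusMagneticFluxPartition ρ β zM φ 0 b₁ b₂ b₃ (M + 2)).re /
            (wilsonFinTorusMagneticFluxPartition ρ β zM φ 0 b₁ b₂ b₃ (M + 1 + 2)).re)) atTop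
      (𝓝 (wilsonFinTorusMagneticFluxEnergy ρ β zM φ ψ b₁ b₂ b₃)) := by
  obtain ⟨lam₀, Λψ, -, -, -, ht, -, -, -, -, heff⟩ := magneticFluxEnergy_spectral ρ hρ hρu hβ zM hφ0 hφadd hφc b₁ b₂ b₃ hψ3
  rw [wilsonFinTorusMagneticFluxEnergy_def, ht.limUnder_eq]
  exact heff

/-! ### §2 Unconditional versions: the population hypothesis discharged by Polyakov lines -/

/-- ★ **The energy of every electric flux with room exists in every magnetic sector, unconditionally**:
`(1/M) log(Re Z_{0,m}(M+2) / Re Z_{χ,m}(M+2)) → E_{χ|m}` for `χ = n₀ψ₀ + n₁ψ₁ + n₂ψ₂`, `n₀ ≤ b₂b₃`, `n₁ ≤ b₁b₃`, `n₂ ≤ b₁b₂`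
(`β > 0`, `N ≥ 1`, sides `≥ 1`, `ρ(φ k i) = ψ_i(k)·1`). [cite: tHooft1979Flux, §4 (4.10) and §5 after (5.4)] -/
theorem tendsto_wilsonFinTorusMagneticFluxEnergy_of_flux (hρ : Continuous ρ)
    (hρu : ∀ g, ρ g ∈ Matrix.unitaryGroup (Fin N) ℂ) [NeZero N] {β : ℝ} (hβ : 0 < β) (zM : Fin 4 → Fin 4 → G)
    {φ : Γ → Fin 4 → G} (hφ0 : φ 0 = 1) (hφadd : ∀ k k', φ (k + k') = φ k * φ k')
    (hφc : ∀ k (i : Fin 3), φ k i.castSucc ∈ Subgroup.center G) {ψ : Fin 3 → AddChar Γ ℂ}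
    (hψ : ∀ (k : Γ) (i : Fin 3), ρ (φ k i.castSucc) = (ψ i k) • (1 : Matrix (Fin N) (Fin N) ℂ))
    {b₁ b₂ b₃ : ℕ} [NeZero b₁] [NeZero b₂] [NeZero b₃] {n₀ n₁ n₂ : ℕ}
    (hn₀ : n₀ ≤ b₂ * b₃) (hn₁ : n₁ ≤ b₁ * b₃) (hn₂ : n₂ ≤ b₁ * b₂) :
    Tendsto (fun M : ℕ => Real.log ((wilsonFinTorusMagneticFluxPartition ρ β zM φ 0 b₁ b₂ b₃ (M + 2)).re /
        (wilsonFinTorusMagneticFluxPartition ρ β zM φ (n₀ • ψ 0 + n₁ • ψ 1 + n₂ • ψ 2) b₁ b₂ b₃ (M + 2)).re) / M) atTop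
      (𝓝 (wilsonFinTorusMagneticFluxEnergy ρ β zM φ (n₀ • ψ 0 + n₁ • ψ 1 + n₂ • ψ 2) b₁ b₂ b₃)) :=
  tendsto_wilsonFinTorusMagneticFluxEnergy ρ hρ hρu hβ.le zM hφ0 hφadd hφc b₁ b₂ b₃
    (wilsonFinTorusMagneticFluxPartition_re_pos_of_flux ρ hρ hρu hβ zM hφ0 hφadd hφc hψ hn₀ hn₁ hn₂ 1)

/-- ★ **Every non-zero electric flux with room costs at least the finite-volume gap in every magnetic sector, unconditionally**:
`−log tanh(3Nβ·b₁b₂b₃) ≤ E_{χ|m}` for `χ = n₀ψ₀ + n₁ψ₁ + n₂ψ₂ ≠ 0` with room. [cite: tHooft1979Flux, §4 (4.10) and §5 after (5.4)]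
[cite: Hopf1963, Thm 4] -/
theorem neg_log_tanh_le_wilsonFinTorusMagneticFluxEnergy_of_flux (hρ : Continuous ρ)
    (hρu : ∀ g, ρ g ∈ Matrix.unitaryGroup (Fin N) ℂ) [NeZero N] {β : ℝ} (hβ : 0 < β) (zM : Fin 4 → Fin 4 → G)
    {φ : Γ → Fin 4 → G} (hφ0 : φ 0 = 1) (hφadd : ∀ k k', φ (k + k') = φ k * φ k')
    (hφc : ∀ k (i : Fin 3), φ k i.castSucc ∈ Subgroup.center G) {ψ : Fin 3 → AddChar Γ ℂ}
    (hψ : ∀ (k : Γ) (i : Fin 3), ρ (φ k i.castSucc) = (ψ i k) • (1 : Matrix (Fin N) (Fin N) ℂ))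
    {b₁ b₂ b₃ : ℕ} [NeZero b₁] [NeZero b₂] [NeZero b₃] {n₀ n₁ n₂ : ℕ}
    (hn₀ : n₀ ≤ b₂ * b₃) (hn₁ : n₁ ≤ b₁ * b₃) (hn₂ : n₂ ≤ b₁ * b₂) (hχ0 : n₀ • ψ 0 + n₁ • ψ 1 + n₂ • ψ 2 ≠ 0) :
    -Real.log (Real.tanh (3 * N * β * ((b₁ : ℝ) * b₂ * b₃))) ≤
      wilsonFinTorusMagneticFluxEnergy ρ β zM φ (n₀ • ψ 0 + n₁ • ψ 1 + n₂ • ψ 2) b₁ b₂ b₃ :=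
  neg_log_tanh_le_wilsonFinTorusMagneticFluxEnergy ρ hρ hρu hβ.le zM hφ0 hφadd hφc b₁ b₂ b₃ hχ0
    (wilsonFinTorusMagneticFluxPartition_re_pos_of_flux ρ hρ hρu hβ zM hφ0 hφadd hφc hψ hn₀ hn₁ hn₂ 1)

/-- ★ **Every non-zero electric flux with room has strictly positive energy in every magnetic sector, unconditionally**:
`0 < E_{χ|m}`. [cite: tHooft1979Flux, §4 (4.10) and §5 after (5.4)] [cite: Hopf1963, Thm 4] -/
theorem wilsonFinTorusMagneticFluxEnergy_pos_of_flux (hρ : Continuous ρ)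
    (hρu : ∀ g, ρ g ∈ Matrix.unitaryGroup (Fin N) ℂ) [NeZero N] {β : ℝ} (hβ : 0 < β) (zM : Fin 4 → Fin 4 → G)
    {φ : Γ → Fin 4 → G} (hφ0 : φ 0 = 1) (hφadd : ∀ k k', φ (k + k') = φ k * φ k')
    (hφc : ∀ k (i : Fin 3), φ k i.castSucc ∈ Subgroup.center G) {ψ : Fin 3 → AddChar Γ ℂ}
    (hψ : ∀ (k : Γ) (i : Fin 3), ρ (φ k i.castSucc) = (ψ i k) • (1 : Matrix (Fin N) (Fin N) ℂ))
    {b₁ b₂ b₃ : ℕ} [NeZero b₁] [NeZero b₂] [NeZero b₃] {n₀ n₁ n₂ : ℕ}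
    (hn₀ : n₀ ≤ b₂ * b₃) (hn₁ : n₁ ≤ b₁ * b₃) (hn₂ : n₂ ≤ b₁ * b₂) (hχ0 : n₀ • ψ 0 + n₁ • ψ 1 + n₂ • ψ 2 ≠ 0) :
    0 < wilsonFinTorusMagneticFluxEnergy ρ β zM φ (n₀ • ψ 0 + n₁ • ψ 1 + n₂ • ψ 2) b₁ b₂ b₃ :=
  wilsonFinTorusMagneticFluxEnergy_pos ρ hρ hρu hβ.le zM hφ0 hφadd hφc b₁ b₂ b₃ hχ0
    (wilsonFinTorusMagneticFluxPartition_re_pos_of_flux ρ hρ hρu hβ zM hφ0 hφadd hφc hψ hn₀ hn₁ hn₂ 1)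

/-- ★ **Every non-zero flux in the subgroup generated by the seen characters has strictly positive energy in every magnetic
sector**, given room `ord(ψ₀) ≤ b₂b₃+1`, `ord(ψ₁) ≤ b₁b₃+1`, `ord(ψ₂) ≤ b₁b₂+1`. [cite: tHooft1979Flux, §4 (4.5)–(4.10) and §5 after (5.4)]
[cite: Hopf1963, Thm 4] -/
theorem wilsonFinTorusMagneticFluxEnergy_pos_of_mem_closure (hρ : Continuous ρ)
    (hρu : ∀ g, ρ g ∈ Matrix.unitaryGroup (Fin N) ℂ) [NeZero N] {β : ℝ} (hβ : 0 < β) (zM : Fin 4 → Fin 4 → G)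
    {φ : Γ → Fin 4 → G} (hφ0 : φ 0 = 1) (hφadd : ∀ k k', φ (k + k') = φ k * φ k')
    (hφc : ∀ k (i : Fin 3), φ k i.castSucc ∈ Subgroup.center G) {ψ : Fin 3 → AddChar Γ ℂ}
    (hψ : ∀ (k : Γ) (i : Fin 3), ρ (φ k i.castSucc) = (ψ i k) • (1 : Matrix (Fin N) (Fin N) ℂ))
    {b₁ b₂ b₃ : ℕ} [NeZero b₁] [NeZero b₂] [NeZero b₃] (h₀ : addOrderOf (ψ 0) ≤ b₂ * b₃ + 1)
    (h₁ : addOrderOf (ψ 1) ≤ b₁ * b₃ + 1) (h₂ : addOrderOf (ψ 2) ≤ b₁ * b₂ + 1) {χ : AddChar Γ ℂ}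
    (hχ : χ ∈ AddSubgroup.closure (Set.range ψ)) (hχ0 : χ ≠ 0) :
    0 < wilsonFinTorusMagneticFluxEnergy ρ β zM φ χ b₁ b₂ b₃ :=
  wilsonFinTorusMagneticFluxEnergy_pos ρ hρ hρu hβ.le zM hφ0 hφadd hφc b₁ b₂ b₃ hχ0
    (wilsonFinTorusMagneticFluxPartition_re_pos_of_mem_closure ρ hρ hρu hβ zM hφ0 hφadd hφc hψ h₀ h₁ h₂ hχ 1)

end Spectral

/-! ### §3 The same for 't Hooft's `e^{−βF(e, m; a, β)}` of `WilsonFinTorusTHooftDuality.lean` -/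

section Transform

/-- **'t Hooft's `E(e, m; a) − E(0, m; a)`**: the energy of the electric flux `e = (ψ₀, ψ₁, ψ₂)` above the ground state of the
magnetic sector `m = (m₁₂, m₀₂, m₀₁)` of the box `a × b × c`,
`lim_M (1/M) · log (Re e^{−F}(0 | m)(a,b,c,M+2) / Re e^{−F}(e | m)(a,b,c,M+2))` («In the limit β → ∞, F becomes the energy of the
lowest state with the given flux configuration»).  Defined through `limUnder`. [cite: tHooft1979Flux, §5 after (5.4) and §8 after (8.7)] -/
def wilsonFinTorusFluxTransformEnergy (β : ℝ) (φ : Γ → G) (ψ₀ ψ₁ ψ₂ : AddChar Γ ℂ) (m₁₂ m₀₂ m₀₁ : Γ)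
    (a b c : ℕ) : ℝ :=
  limUnder atTop fun M : ℕ =>
    Real.log ((wilsonFinTorusFluxTransform ρ β φ 0 0 0 m₁₂ m₀₂ m₀₁ a b c (M + 2)).re /
        (wilsonFinTorusFluxTransform ρ β φ ψ₀ ψ₁ ψ₂ m₁₂ m₀₂ m₀₁ a b c (M + 2)).re) / M

/-- Unfolding lemma. [cite: tHooft1979Flux, §5 after (5.4)] -/
theorem wilsonFinTorusFluxTransformEnergy_def (β : ℝ) (φ : Γ → G) (ψ₀ ψ₁ ψ₂ : AddChar Γ ℂ) (m₁₂ m₀₂ m₀₁ : Γ)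
    (a b c : ℕ) :
    wilsonFinTorusFluxTransformEnergy ρ β φ ψ₀ ψ₁ ψ₂ m₁₂ m₀₂ m₀₁ a b c = limUnder atTop (fun M : ℕ =>
      Real.log ((wilsonFinTorusFluxTransform ρ β φ 0 0 0 m₁₂ m₀₂ m₀₁ a b c (M + 2)).re /
        (wilsonFinTorusFluxTransform ρ β φ ψ₀ ψ₁ ψ₂ m₁₂ m₀₂ m₀₁ a b c (M + 2)).re) / M) := rfl

/-- **BRIDGE**: 't Hooft's `E(e,m) − E(0,m)` is the `Γ³`-family energy at the magnetic tensor of `m` and the flux character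
`tripleFluxChar ψ₀ ψ₁ ψ₂` (`φ 0 = 1`). [cite: tHooft1979Flux, §5 (5.4)] -/
theorem wilsonFinTorusFluxTransformEnergy_eq_magneticFluxEnergy (β : ℝ) {φ : Γ → G} (hφ0 : φ 0 = 1)
    (ψ₀ ψ₁ ψ₂ : AddChar Γ ℂ) (m₁₂ m₀₂ m₀₁ : Γ) (a b c : ℕ) :
    wilsonFinTorusFluxTransformEnergy ρ β φ ψ₀ ψ₁ ψ₂ m₁₂ m₀₂ m₀₁ a b c =
      wilsonFinTorusMagneticFluxEnergy ρ β (fun μ ν => φ (twistIdx (0 : Γ) 0 0 m₁₂ m₀₂ m₀₁ μ ν))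
        (fun k : Γ × Γ × Γ => ![φ k.1, φ k.2.1, φ k.2.2, 1]) (tripleFluxChar ψ₀ ψ₁ ψ₂) a b c := by
  have htriv : tripleFluxChar (0 : AddChar Γ ℂ) 0 0 = 0 := (tripleFluxChar_eq_zero_iff 0 0 0).2 ⟨rfl, rfl, rfl⟩
  simp only [wilsonFinTorusFluxTransformEnergy_def, wilsonFinTorusMagneticFluxEnergy_def,
    wilsonFinTorusFluxTransform_eq_magneticFluxPartition ρ β hφ0, htriv]

/-- `E(0, m) − E(0, m) = 0` (no hypotheses). [cite: tHooft1979Flux, §8 after (8.7)] -/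
theorem wilsonFinTorusFluxTransformEnergy_zero (β : ℝ) (φ : Γ → G) (m₁₂ m₀₂ m₀₁ : Γ) (a b c : ℕ) :
    wilsonFinTorusFluxTransformEnergy ρ β φ 0 0 0 m₁₂ m₀₂ m₀₁ a b c = 0 := by
  rw [wilsonFinTorusFluxTransformEnergy_def]
  have h : (fun M : ℕ => Real.log ((wilsonFinTorusFluxTransform ρ β φ 0 0 0 m₁₂ m₀₂ m₀₁ a b c (M + 2)).re /
      (wilsonFinTorusFluxTransform ρ β φ 0 0 0 m₁₂ m₀₂ m₀₁ a b c (M + 2)).re) / (M : ℝ)) = fun _ => 0 := by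
    funext M
    rcases eq_or_ne ((wilsonFinTorusFluxTransform ρ β φ 0 0 0 m₁₂ m₀₂ m₀₁ a b c (M + 2)).re) 0 with h0 | h0
    · simp [h0]
    · simp [div_self h0]
  rw [h]
  exact tendsto_const_nhds.limUnder_eq

variable [SecondCountableTopology G]

omit [TopologicalSpace G] [IsTopologicalGroup G] [CompactSpace G] [MeasurableSpace G] [BorelSpace G]
  [SecondCountableTopology G] [Fintype Γ] in
/-- The three-slot twist family of a hom-like centre-valued `φ` seen through `χ` (plumbing). [cite: tHooft1979Flux, §4 (4.2)–(4.5)] -/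
private theorem mge_tripleTwist_hom {φ : Γ → G} (hφ0 : φ 0 = 1) (hφadd : ∀ k k', φ (k + k') = φ k * φ k')
    (hφc : ∀ k, φ k ∈ Subgroup.center G) {χ : AddChar Γ ℂ}
    (hχ : ∀ k, ρ (φ k) = (χ k) • (1 : Matrix (Fin N) (Fin N) ℂ)) :
    (fun k : Γ × Γ × Γ => (![φ k.1, φ k.2.1, φ k.2.2, 1] : Fin 4 → G)) 0 = 1 ∧
      (∀ k k' : Γ × Γ × Γ, (![φ (k + k').1, φ (k + k').2.1, φ (k + k').2.2, 1] : Fin 4 → G) =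
        ![φ k.1, φ k.2.1, φ k.2.2, 1] * ![φ k'.1, φ k'.2.1, φ k'.2.2, 1]) ∧
      (∀ (k : Γ × Γ × Γ) (i : Fin 3), (![φ k.1, φ k.2.1, φ k.2.2, 1] : Fin 4 → G) i.castSucc ∈ Subgroup.center G) ∧
      ∀ (k : Γ × Γ × Γ) (i : Fin 3), ρ ((![φ k.1, φ k.2.1, φ k.2.2, 1] : Fin 4 → G) i.castSucc) =
        ((![tripleFluxChar χ 0 0, tripleFluxChar 0 χ 0, tripleFluxChar 0 0 χ] : Fin 3 → AddChar (Γ × Γ × Γ) ℂ) i k) •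
          (1 : Matrix (Fin N) (Fin N) ℂ) := by
  refine ⟨?_, fun k k' => ?_, fun k i => ?_, fun k i => ?_⟩
  · funext μ
    fin_cases μ <;> simp [hφ0]
  · funext μ
    fin_cases μ <;> simp [hφadd]
  · fin_cases i
    · exact hφc _
    · exact hφc _
    · exact hφc _
  · fin_cases i <;> simp [hχ]

/-- ★ **'t Hooft's limit exists for every electric flux seen by `ρ`, in every magnetic sector, unconditionally**:
`(1/M) log (Re e^{−F}(0|m)(M+2) / Re e^{−F}(n₀χ,n₁χ,n₂χ|m)(M+2)) → E(e,m) − E(0,m)`; `β > 0`, `N ≥ 1`, `ρ(φ k) = χ(k)·1`, sides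
`≥ 1`, `n₀ ≤ bc`, `n₁ ≤ ac`, `n₂ ≤ ab`. [cite: tHooft1979Flux, §4 (4.10) and §5 after (5.4)] -/
theorem tendsto_wilsonFinTorusFluxTransformEnergy_of_flux (hρ : Continuous ρ)
    (hρu : ∀ g, ρ g ∈ Matrix.unitaryGroup (Fin N) ℂ) [NeZero N] {β : ℝ} (hβ : 0 < β) {φ : Γ → G} (hφ0 : φ 0 = 1)
    (hφadd : ∀ k k', φ (k + k') = φ k * φ k') (hφc : ∀ k, φ k ∈ Subgroup.center G) {χ : AddChar Γ ℂ}
    (hχ : ∀ k, ρ (φ k) = (χ k) • (1 : Matrix (Fin N) (Fin N) ℂ)) (m₁₂ m₀₂ m₀₁ : Γ)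
    {a b c : ℕ} [NeZero a] [NeZero b] [NeZero c] {n₀ n₁ n₂ : ℕ} (hn₀ : n₀ ≤ b * c) (hn₁ : n₁ ≤ a * c)
    (hn₂ : n₂ ≤ a * b) :
    Tendsto (fun M : ℕ => Real.log ((wilsonFinTorusFluxTransform ρ β φ 0 0 0 m₁₂ m₀₂ m₀₁ a b c (M + 2)).re /
        (wilsonFinTorusFluxTransform ρ β φ (n₀ • χ) (n₁ • χ) (n₂ • χ) m₁₂ m₀₂ m₀₁ a b c (M + 2)).re) / M) atTop
      (𝓝 (wilsonFinTorusFluxTransformEnergy ρ β φ (n₀ • χ) (n₁ • χ) (n₂ • χ) m₁₂ m₀₂ m₀₁ a b c)) := by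
  obtain ⟨h0, hadd, hc, hseen⟩ := mge_tripleTwist_hom ρ hφ0 hφadd hφc hχ
  have htriv : tripleFluxChar (0 : AddChar Γ ℂ) 0 0 = 0 := (tripleFluxChar_eq_zero_iff 0 0 0).2 ⟨rfl, rfl, rfl⟩
  have h := tendsto_wilsonFinTorusMagneticFluxEnergy_of_flux ρ hρ hρu hβ
    (fun μ ν => φ (twistIdx (0 : Γ) 0 0 m₁₂ m₀₂ m₀₁ μ ν)) h0 hadd hc hseen hn₀ hn₁ hn₂
  rw [wilsonFinTorusFluxTransformEnergy_eq_magneticFluxEnergy ρ β hφ0]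
  simp only [wilsonFinTorusFluxTransform_eq_magneticFluxPartition ρ β hφ0, tripleFluxChar_nsmul, htriv]
  simpa using h

/-- ★ **`E(e,m) − E(0,m) ≥ −log tanh(3Nβ·abc)` for every non-zero electric flux seen by `ρ`, in every magnetic sector,
unconditionally** (one box). [cite: tHooft1979Flux, §4 (4.10) and §5 after (5.4)] [cite: Hopf1963, Thm 4] -/
theorem neg_log_tanh_le_wilsonFinTorusFluxTransformEnergy_of_flux (hρ : Continuous ρ)
    (hρu : ∀ g, ρ g ∈ Matrix.unitaryGroup (Fin N) ℂ) [NeZero N] {β : ℝ} (hβ : 0 < β) {φ : Γ → G} (hφ0 : φ 0 = 1)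
    (hφadd : ∀ k k', φ (k + k') = φ k * φ k') (hφc : ∀ k, φ k ∈ Subgroup.center G) {χ : AddChar Γ ℂ}
    (hχ : ∀ k, ρ (φ k) = (χ k) • (1 : Matrix (Fin N) (Fin N) ℂ)) (m₁₂ m₀₂ m₀₁ : Γ)
    {a b c : ℕ} [NeZero a] [NeZero b] [NeZero c] {n₀ n₁ n₂ : ℕ} (hn₀ : n₀ ≤ b * c) (hn₁ : n₁ ≤ a * c)
    (hn₂ : n₂ ≤ a * b) (he : ¬ (n₀ • χ = 0 ∧ n₁ • χ = 0 ∧ n₂ • χ = 0)) :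
    -Real.log (Real.tanh (3 * N * β * ((a : ℝ) * b * c))) ≤
      wilsonFinTorusFluxTransformEnergy ρ β φ (n₀ • χ) (n₁ • χ) (n₂ • χ) m₁₂ m₀₂ m₀₁ a b c := by
  obtain ⟨h0, hadd, hc, hseen⟩ := mge_tripleTwist_hom ρ hφ0 hφadd hφc hχ
  have hne : tripleFluxChar (n₀ • χ) (n₁ • χ) (n₂ • χ) ≠ 0 := fun h => he ((tripleFluxChar_eq_zero_iff _ _ _).1 h)
  rw [wilsonFinTorusFluxTransformEnergy_eq_magneticFluxEnergy ρ β hφ0]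
  rw [tripleFluxChar_nsmul] at hne ⊢
  exact neg_log_tanh_le_wilsonFinTorusMagneticFluxEnergy_of_flux ρ hρ hρu hβ _ h0 hadd hc hseen hn₀ hn₁ hn₂ hne

/-- ★ **`E(e,m) − E(0,m) > 0` for every non-zero electric flux seen by `ρ`, in every magnetic sector, unconditionally** — for
`SU(N)`, the fundamental `ρ` and 't Hooft's centre twists: every `(e, m)` with `e ≠ 0` of a box with `min(ab,ac,bc) ≥ N − 1`.
[cite: tHooft1979Flux, §4 (4.10) and §5 after (5.4)] [cite: Hopf1963, Thm 4] -/
theorem wilsonFinTorusFluxTransformEnergy_pos_of_flux (hρ : Continuous ρ)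
    (hρu : ∀ g, ρ g ∈ Matrix.unitaryGroup (Fin N) ℂ) [NeZero N] {β : ℝ} (hβ : 0 < β) {φ : Γ → G} (hφ0 : φ 0 = 1)
    (hφadd : ∀ k k', φ (k + k') = φ k * φ k') (hφc : ∀ k, φ k ∈ Subgroup.center G) {χ : AddChar Γ ℂ}
    (hχ : ∀ k, ρ (φ k) = (χ k) • (1 : Matrix (Fin N) (Fin N) ℂ)) (m₁₂ m₀₂ m₀₁ : Γ)
    {a b c : ℕ} [NeZero a] [NeZero b] [NeZero c] {n₀ n₁ n₂ : ℕ} (hn₀ : n₀ ≤ b * c) (hn₁ : n₁ ≤ a * c)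
    (hn₂ : n₂ ≤ a * b) (he : ¬ (n₀ • χ = 0 ∧ n₁ • χ = 0 ∧ n₂ • χ = 0)) :
    0 < wilsonFinTorusFluxTransformEnergy ρ β φ (n₀ • χ) (n₁ • χ) (n₂ • χ) m₁₂ m₀₂ m₀₁ a b c := by
  obtain ⟨h0, hadd, hc, hseen⟩ := mge_tripleTwist_hom ρ hφ0 hφadd hφc hχ
  have hne : tripleFluxChar (n₀ • χ) (n₁ • χ) (n₂ • χ) ≠ 0 := fun h => he ((tripleFluxChar_eq_zero_iff _ _ _).1 h)
  rw [wilsonFinTorusFluxTransformEnergy_eq_magneticFluxEnergy ρ β hφ0]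
  rw [tripleFluxChar_nsmul] at hne ⊢
  exact wilsonFinTorusMagneticFluxEnergy_pos_of_flux ρ hρ hρu hβ _ h0 hadd hc hseen hn₀ hn₁ hn₂ hne

end Transform

end Literature.MathematicalPhysics.QuantumFieldTheory

end
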